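import Summits.CriticalPhenomena.Ising3DConformalLimit.Theses.LinkingParityCircles
import Summits.CriticalPhenomena.Ising3DConformalLimit.Theorems.RotationUpgradeFromTwoPoint.Negative.ContinuityFree
import HarnessLib

/-!
# Crux `LinkingParityCircles.SpinRatioMoebius` (stmt-CriticalPhenomena-4530), line `registered` —
# stub `stub_cellLimitContinuous`: continuity of mesh limits is FREE

Generalisation of `RotationUpgradeFromTwoPointNegative.limit_continuousOn` (stated for the rescaled
critical correlators) to an ARBITRARY family `F δ : ((ℝ³)ⁿ → ℝ)` of mesh-`δ` CELL functionals —
`F δ x` depends on `x` only through the cells `⌊x i j / δ⌋` — whose locally uniform limit `g` on the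
non-coincident configurations is translation invariant there (which is itself free for lattice-shift
invariant families, stub `stub_cellLimitTranslate`): `g` is continuous on `NonCoincident 3 n`.

Mechanism (verbatim the tree's, `exists_cellmate_shift`): locally uniform convergence alone does not
make a limit of step functions continuous, but for two nearby configurations `x, y` (all `3n`
coordinates within `δ/(n+1)`) a COMMON real shift `w` with `x + w`, `y + w` in the same mesh-`δ` cells
exists (pigeonhole on each axis), and then `g y = g (y + w) ≈ F δ (y + w) = F δ (x + w) ≈ g (x + w) = g x`.

References: S. Friedli, Y. Velenik, *Statistical Mechanics of Lattice Systems* (CUP 2017), Thm. 3.17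
(translation invariance, entering through the hypothesis).
-/

noncomputable section

namespace Summit.CriticalPhenomena.Ising3DConformalLimit.Cruxes.SpinRatioMoebius.Birth

open Literature.Probability.LatticeModels Filter Set
open Summit.CriticalPhenomena.Ising3DConformalLimit.MoebiusLimitExistsNegative
open Summit.CriticalPhenomena.Ising3DConformalLimit.RotationUpgradeFromTwoPointNegative
open scoped Topology

/-- **Stub `stub_cellLimitContinuous` (continuity of mesh limits is free).** If `F δ x` depends on
`x` only through the mesh-`δ` cells of its coordinates, `g` is translation invariant on
`NonCoincident 3 n`, and `F δ → g` locally uniformly there as `δ → 0⁺`, then `g` is continuous on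
`NonCoincident 3 n`. [cite: FriedliVelenik2017, Thm. 3.17] -/
theorem stub_cellLimitContinuous :
    ∀ (n : ℕ) (F : ℝ → (Fin n → EuclideanSpace ℝ (Fin 3)) → ℝ) (g : (Fin n → EuclideanSpace ℝ (Fin 3)) → ℝ), (∀ δ : ℝ, 0 < δ → ∀ x y : Fin n → EuclideanSpace ℝ (Fin 3), (∀ i j, ⌊x i j / δ⌋ = ⌊y i j / δ⌋) → F δ x = F δ y) → (∀ (v : EuclideanSpace ℝ (Fin 3)), ∀ x ∈ Literature.Probability.LatticeModels.NonCoincident 3 n, g (fun i => x i + v) = g x) → TendstoLocallyUniformlyOn F g (nhdsWithin 0 (Set.Ioi 0)) (Literature.Probability.LatticeModels.NonCoincident 3 n) → ContinuousOn g (Literature.Probability.LatticeModels.NonCoincident 3 n) := by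
  intro n F g hcell htrans hlim x₀ hx₀
  rw [Metric.continuousWithinAt_iff]
  intro ε hε
  have hε3 : 0 < ε / 3 := by positivity
  have hU := hlim
  rw [Metric.tendstoLocallyUniformlyOn_iff] at hU
  obtain ⟨t, ht, hev⟩ := hU (ε / 3) hε3 x₀ hx₀
  obtain ⟨r, hr, hsub⟩ := Metric.mem_nhdsWithin_iff.1 ht
  -- a mesh `δ < r/4` at which the uniform estimate holds on `t`
  have hr4 : (0 : ℝ) < r / 4 := by positivity
  obtain ⟨δ, hPδ, hδmem⟩ := (hev.and (Ioo_mem_nhdsGT hr4)).exists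
  have hδ : 0 < δ := hδmem.1
  have hδr : δ < r / 4 := hδmem.2
  have hn1 : (0 : ℝ) < n + 1 := by positivity
  refine ⟨δ / (n + 1), by positivity, fun {y} hy hdist => ?_⟩
  -- coordinates of `y` and `x₀` are within `δ/(n+1)`
  have hcoord : ∀ i j, |x₀ i j - y i j| < δ / (n + 1) := by
    intro i j
    have hi : dist (y i) (x₀ i) < δ / (n + 1) := (dist_pi_lt_iff (by positivity)).1 hdist i
    rw [dist_eq_norm] at hi
    calc |x₀ i j - y i j| = |(y i - x₀ i) j| := by
          rw [abs_sub_comm]; rfl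
      _ ≤ ‖y i - x₀ i‖ := abs_apply_le_norm _ _
      _ < δ / (n + 1) := hi
  obtain ⟨w, hwnorm, hcellw⟩ := exists_cellmate_shift hδ x₀ y hcoord
  -- the shifted configurations lie in `ball x₀ r ∩ NonCoincident`, hence in `t`
  have hδn : δ / (n + 1) ≤ δ := div_le_self hδ.le (by linarith)
  have hx' : (fun i => x₀ i + w) ∈ t := by
    refine hsub ⟨?_, (add_mem_nonCoincident_iff w x₀).2 hx₀⟩
    rw [Metric.mem_ball]
    rcases Nat.eq_zero_or_pos n with hn | hn
    · subst hn
      have : (fun i : Fin 0 => x₀ i + w) = x₀ := funext fun i => i.elim0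
      rw [this, dist_self]; exact hr
    · haveI : Nonempty (Fin n) := ⟨⟨0, hn⟩⟩
      refine (dist_pi_lt_iff hr).2 fun i => ?_
      rw [dist_eq_norm, add_sub_cancel_left]
      linarith
  have hy' : (fun i => y i + w) ∈ t := by
    refine hsub ⟨?_, (add_mem_nonCoincident_iff w y).2 hy⟩
    rw [Metric.mem_ball]
    rcases Nat.eq_zero_or_pos n with hn | hn
    · subst hn
      have : (fun i : Fin 0 => y i + w) = x₀ := funext fun i => i.elim0
      rw [this, dist_self]; exact hr
    · haveI : Nonempty (Fin n) := ⟨⟨0, hn⟩⟩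
      refine (dist_pi_lt_iff hr).2 fun i => ?_
      have hi : dist (y i) (x₀ i) < δ / (n + 1) := (dist_pi_lt_iff (by positivity)).1 hdist i
      calc dist (y i + w) (x₀ i) ≤ dist (y i + w) (y i) + dist (y i) (x₀ i) := dist_triangle _ _ _
        _ = ‖w‖ + dist (y i) (x₀ i) := by rw [dist_eq_norm, add_sub_cancel_left]
        _ < r := by linarith
  -- assemble: `g y = g (y+w) ≈ F (y+w) = F (x₀+w) ≈ g (x₀+w) = g x₀`
  have h1 := hPδ _ hx'
  have h2 := hPδ _ hy'
  have hF : F δ (fun i => x₀ i + w) = F δ (fun i => y i + w) :=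
    hcell δ hδ _ _ fun i j => hcellw i j
  rw [htrans w x₀ hx₀] at h1
  rw [htrans w y hy, ← hF] at h2
  rw [dist_comm] at h1
  calc dist (g y) (g x₀)
      ≤ dist (g y) (F δ fun i => x₀ i + w) + dist (F δ fun i => x₀ i + w) (g x₀) := dist_triangle _ _ _
    _ < ε / 3 + ε / 3 := add_lt_add h2 h1
    _ < ε := by linarith

end Summit.CriticalPhenomena.Ising3DConformalLimit.Cruxes.SpinRatioMoebius.Birth

end
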